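import Summits.KontsevichZagierPeriods.Zeta5Search.Barrier.ConeGammaRegularOpen
import Summits.KontsevichZagierPeriods.Zeta5Search.Barrier.ConeGammaLogCuspSlope

/-!
# ζ(5) search — BARRIER: the log-cusp of `γ` with the NAMED slope at Regular directions; no local maximum where a
# cusp slope is positive

HONEST FRAMING (cell `pub-zeta5`): systematic search; no irrationality claim unless kernel-certified. MODEL objects
under Brown–Zudilin's (28)+(30) accounting ([BZ22] = arXiv:2210.03391; (28) observed, not proved); statements about
the sSup-form `C1`/`C0`/`Regular`/`gamma` of `ConeGammaRates` and the named slope `cuspSlope` of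
`ConeGammaLogCuspSlope`; nothing here is a statement about the size of any critical value, the SIGN of any cusp slope
at any direction, the cone's supremum (C2 = `BarrierC2`, OPEN), S-E (CONJECTURED) or `ζ(5)`. No number or sentence
of record moves. Records in print UNMOVED. Prover P2 g23 (self-selected Lean-only item «BZ's cubic (20) in the
kernel», file 6: `ConeGammaLogCuspGamma`'s READING «(Cor. 2's «only if») a direction with `σ(δ) > 0` for some `δ` and
`C₁ > C₀` is not a local maximiser of `γ`», now a theorem at every Regular open-box direction).

* `C0_lt_C1_of_regular` — at a Regular direction `C₀ < C₁` strictly (three distinct values);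
* **`gamma_logCusp_of_regular_cuspSlope`** — `|γ(s(a)+εδ) − γ(a) − ((C₁−C₀)/Q²)·(cuspSlope a T δ / T)·ε·log(1/ε)|
  ≤ C′ε` for `0 < ε ≤ ε₄`, at every Regular open-box direction with `Q = C₁ + δ₂₈ − Φ > 0` (no Lipschitz hypothesis);
* **`gamma_diffQuot_tendsto_of_regular`** — `cuspSlope a T δ > 0 ⇒ (γ(s(a)+εδ) − γ(a))/ε → +∞` and
  `< 0 ⇒ → −∞` as `ε → 0⁺`: at such a direction `γ` has no finite one-sided derivative along `δ`;
* `aOfS_sParam_add_smul` — `aOfS (s(a) + ε·δ) = a + ε·aOfS δ`;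
* **`not_isLocalMax_gamma_of_cuspSlope_pos`**, `not_isLocalMin_gamma_of_cuspSlope_neg`,
  **`cuspSlope_nonpos_of_isLocalMax`** — a Regular open-box direction with `Q > 0` at which SOME displacement `δ` has
  positive cusp slope (for SOME period `T` of the forms) is NOT a local maximiser of `γ` on `Dir`; equivalently,
  at a Regular open-box local maximiser of `γ` every cusp slope is `≤ 0`.
READING (MODEL, no number moves): an interior Regular maximiser of `γ` — if C2's supremum were attained at such a
direction — is a «cusp top»: `cuspSlope a T δ ≤ 0` for every displacement `δ` and every period `T`.
-/

noncomputable section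

open Set Metric Filter
open scoped Topology

namespace Summit.KontsevichZagierPeriods.Zeta5Search.Barrier.ConeGamma

/-- **At a Regular direction `C₀ < C₁`** (the second largest of three distinct values is below the largest). -/
theorem C0_lt_C1_of_regular {a : Dir} (hreg : Regular a) : C0 a < C1 a := by
  obtain ⟨u, v, w, huv, huw, hvw, hset⟩ := Set.ncard_eq_three.mp hreg
  obtain ⟨x, y, z, hxy, hyz, hset'⟩ := exists_sorted_three huv huw hvw
  rw [hset'] at hset
  rw [C0_eq_of_critVals_eq_three hset hxy hyz, C1_eq_of_critVals_eq_three hset hxy hyz]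
  exact hyz

/-- **The log-cusp of `γ` with the named slope, unconditionally at Regular open-box directions.** -/
theorem gamma_logCusp_of_regular_cuspSlope {a : Dir}
    (hopen : ∀ j : Fin 7, 0 < sParam a j.succ ∧ sParam a j.succ < sParam a 0)
    {T : ℝ} (hT : 0 < T) (hper : ∀ k : Fin 28, ∃ z : ℤ, T * h28 a k = z) (δ : Fin 8 → ℝ)
    (hQ : 0 < C1 a + delta28 a - phi30 a) (hreg : Regular a) :
    ∃ C' ε₄ : ℝ, 0 < ε₄ ∧ ∀ ε, 0 < ε → ε ≤ ε₄ →
      |gamma (aOfS (sParam a + ε • δ)) - gamma a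
        - (C1 a - C0 a) / (C1 a + delta28 a - phi30 a) ^ 2 * (cuspSlope a T δ / T) * ε * Real.log (1 / ε)|
          ≤ C' * ε := by
  obtain ⟨σ, C', ε₄, hε₄, hσ, hexp⟩ := gamma_logCusp_of_regular hopen hT hper δ hQ hreg
  rw [eq_cuspSlope_of_spec (h28_pos_of_openBox hopen) hT hper δ hσ] at hexp
  exact ⟨C', ε₄, hε₄, hexp⟩

/-- **No finite one-sided derivative of `γ` along a displacement with non-zero cusp slope**: at a Regular open-box
direction with `Q > 0`, `cuspSlope a T δ > 0 ⇒ (γ(s(a)+εδ) − γ(a))/ε → +∞` and `< 0 ⇒ → −∞` (`ε → 0⁺`). -/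
theorem gamma_diffQuot_tendsto_of_regular {a : Dir}
    (hopen : ∀ j : Fin 7, 0 < sParam a j.succ ∧ sParam a j.succ < sParam a 0)
    {T : ℝ} (hT : 0 < T) (hper : ∀ k : Fin 28, ∃ z : ℤ, T * h28 a k = z) (δ : Fin 8 → ℝ)
    (hQ : 0 < C1 a + delta28 a - phi30 a) (hreg : Regular a) :
    (0 < cuspSlope a T δ → Tendsto (fun ε => (gamma (aOfS (sParam a + ε • δ)) - gamma a) / ε)
        (𝓝[>] 0) atTop) ∧
      (cuspSlope a T δ < 0 → Tendsto (fun ε => (gamma (aOfS (sParam a + ε • δ)) - gamma a) / ε)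
        (𝓝[>] 0) atBot) := by
  obtain ⟨C', ε₄, hε₄, hexp⟩ := gamma_logCusp_of_regular_cuspSlope hopen hT hper δ hQ hreg
  have hκ : 0 < (C1 a - C0 a) / (C1 a + delta28 a - phi30 a) ^ 2 :=
    div_pos (sub_pos.mpr (C0_lt_C1_of_regular hreg)) (pow_pos hQ 2)
  have hlog : Tendsto (fun ε : ℝ => Real.log (1 / ε)) (𝓝[>] 0) atTop := by
    refine (tendsto_neg_atBot_atTop.comp Real.tendsto_log_nhdsGT_zero).congr' ?_
    filter_upwards [self_mem_nhdsWithin] with ε _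
    simp [Real.log_inv]
  refine ⟨fun hσ => ?_, fun hσ => ?_⟩
  · have hev : ∀ᶠ ε in 𝓝[>] (0 : ℝ),
        (C1 a - C0 a) / (C1 a + delta28 a - phi30 a) ^ 2 * (cuspSlope a T δ / T) * Real.log (1 / ε) + -C'
          ≤ (gamma (aOfS (sParam a + ε • δ)) - gamma a) / ε := by
      filter_upwards [Ioo_mem_nhdsGT hε₄] with ε hε
      have h := (abs_le.mp (hexp ε hε.1 hε.2.le)).1
      rw [le_div_iff₀ hε.1]
      linarith
    exact tendsto_atTop_mono' _ hev
      (tendsto_atTop_add_const_right _ (-C') (hlog.const_mul_atTop (mul_pos hκ (div_pos hσ hT))))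
  · have hev : ∀ᶠ ε in 𝓝[>] (0 : ℝ),
        (gamma (aOfS (sParam a + ε • δ)) - gamma a) / ε
          ≤ (C1 a - C0 a) / (C1 a + delta28 a - phi30 a) ^ 2 * (cuspSlope a T δ / T) * Real.log (1 / ε) + C' := by
      filter_upwards [Ioo_mem_nhdsGT hε₄] with ε hε
      have h := (abs_le.mp (hexp ε hε.1 hε.2.le)).2
      rw [div_le_iff₀ hε.1]
      linarith
    exact tendsto_atBot_mono' _ hev
      (tendsto_atBot_add_const_right _ C'
        (hlog.const_mul_atTop_of_neg (mul_neg_of_pos_of_neg hκ (div_neg_of_neg_of_pos hσ hT))))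

/-- The perturbed direction in `Dir`: `aOfS (s(a) + ε·δ) = a + ε·aOfS δ` (`aOfS` is linear). -/
theorem aOfS_sParam_add_smul (a : Dir) (ε : ℝ) (δ : Fin 8 → ℝ) :
    aOfS (sParam a + ε • δ) = a + ε • aOfS δ := by
  ext i
  fin_cases i <;> simp [aOfS, sParam] <;> ring

/-- The perturbed direction is within `ε·‖aOfS δ‖` of `a`. -/
theorem dist_aOfS_sParam_add_smul (a : Dir) {ε : ℝ} (hε : 0 ≤ ε) (δ : Fin 8 → ℝ) :
    dist (aOfS (sParam a + ε • δ)) a = ε * ‖aOfS δ‖ := by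
  rw [aOfS_sParam_add_smul, dist_eq_norm, add_sub_cancel_left, norm_smul, Real.norm_eq_abs, abs_of_nonneg hε]

/-- **NO LOCAL MAXIMUM OF `γ` WHERE A CUSP SLOPE IS POSITIVE.** At a Regular open-box direction with
`Q = C₁ + δ₂₈ − Φ > 0`: if for some period `T` of the forms and some displacement `δ` the cusp slope
`cuspSlope a T δ` is positive, then `a` is not a local maximiser of `γ` on `Dir` (along `ε ↦ a + ε·aOfS δ` the rate
function rises like `ε·log(1/ε)`, beating every `C′ε`). -/
theorem not_isLocalMax_gamma_of_cuspSlope_pos {a : Dir}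
    (hopen : ∀ j : Fin 7, 0 < sParam a j.succ ∧ sParam a j.succ < sParam a 0)
    {T : ℝ} (hT : 0 < T) (hper : ∀ k : Fin 28, ∃ z : ℤ, T * h28 a k = z) {δ : Fin 8 → ℝ}
    (hQ : 0 < C1 a + delta28 a - phi30 a) (hreg : Regular a) (hslope : 0 < cuspSlope a T δ) :
    ¬ IsLocalMax gamma a := by
  intro hmax
  obtain ⟨C', ε₄, hε₄, hexp⟩ := gamma_logCusp_of_regular_cuspSlope hopen hT hper δ hQ hreg
  have hκ : 0 < (C1 a - C0 a) / (C1 a + delta28 a - phi30 a) ^ 2 :=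
    div_pos (sub_pos.mpr (C0_lt_C1_of_regular hreg)) (pow_pos hQ 2)
  -- the positive cusp coefficient `k`
  obtain ⟨k, hkdef⟩ : ∃ k : ℝ, k = (C1 a - C0 a) / (C1 a + delta28 a - phi30 a) ^ 2 * (cuspSlope a T δ / T) :=
    ⟨_, rfl⟩
  have hk : 0 < k := by rw [hkdef]; exact mul_pos hκ (div_pos hslope hT)
  -- the radius of local maximality
  obtain ⟨r, hr, hball⟩ := Metric.eventually_nhds_iff.mp hmax
  -- a small `ε`: below `ε₄`, below the radius, and with `k·log(1/ε) > |C'|`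
  obtain ⟨ε, hεdef⟩ : ∃ ε : ℝ, ε = min (min ε₄ (r / (2 * (‖aOfS δ‖ + 1)))) (Real.exp (-(|C'| / k + 1))) :=
    ⟨_, rfl⟩
  have hε : 0 < ε := by rw [hεdef]; positivity
  have hε₁ : ε ≤ ε₄ := by rw [hεdef]; exact (min_le_left _ _).trans (min_le_left _ _)
  have hε₂ : ε ≤ r / (2 * (‖aOfS δ‖ + 1)) := by rw [hεdef]; exact (min_le_left _ _).trans (min_le_right _ _)
  have hε₃ : ε ≤ Real.exp (-(|C'| / k + 1)) := by rw [hεdef]; exact min_le_right _ _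
  -- `log(1/ε) ≥ |C'|/k + 1`
  have hlog : |C'| / k + 1 ≤ Real.log (1 / ε) := by
    rw [one_div, Real.log_inv]
    have h := Real.log_le_log hε hε₃
    rw [Real.log_exp] at h
    linarith
  -- the perturbed direction is inside the radius
  have hdist : dist (aOfS (sParam a + ε • δ)) a < r := by
    rw [dist_aOfS_sParam_add_smul a hε.le δ]
    calc ε * ‖aOfS δ‖ ≤ r / (2 * (‖aOfS δ‖ + 1)) * ‖aOfS δ‖ := mul_le_mul_of_nonneg_right hε₂ (norm_nonneg _)
      _ ≤ r / (2 * (‖aOfS δ‖ + 1)) * (‖aOfS δ‖ + 1) :=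
          mul_le_mul_of_nonneg_left (by linarith) (by positivity)
      _ = r / 2 := by field_simp
      _ < r := by linarith
  have hle := hball hdist
  -- but `γ` rose by at least `ε·(k·log(1/ε) − C') > 0`
  have hcusp := (abs_le.mp (hexp ε hε hε₁)).1
  rw [← hkdef] at hcusp
  have hgain : 0 < k * ε * Real.log (1 / ε) - C' * ε := by
    have h1 : |C'| + k ≤ k * Real.log (1 / ε) := by
      have := mul_le_mul_of_nonneg_left hlog hk.le
      rw [mul_add, mul_one, mul_div_cancel₀ _ hk.ne'] at this
      exact this
    have h2 := le_abs_self C'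
    nlinarith
  linarith

/-- Symmetrically: **no local minimum of `γ` where a cusp slope is negative.** -/
theorem not_isLocalMin_gamma_of_cuspSlope_neg {a : Dir}
    (hopen : ∀ j : Fin 7, 0 < sParam a j.succ ∧ sParam a j.succ < sParam a 0)
    {T : ℝ} (hT : 0 < T) (hper : ∀ k : Fin 28, ∃ z : ℤ, T * h28 a k = z) {δ : Fin 8 → ℝ}
    (hQ : 0 < C1 a + delta28 a - phi30 a) (hreg : Regular a) (hslope : cuspSlope a T δ < 0) :
    ¬ IsLocalMin gamma a := by
  intro hmin
  obtain ⟨C', ε₄, hε₄, hexp⟩ := gamma_logCusp_of_regular_cuspSlope hopen hT hper δ hQ hreg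
  have hκ : 0 < (C1 a - C0 a) / (C1 a + delta28 a - phi30 a) ^ 2 :=
    div_pos (sub_pos.mpr (C0_lt_C1_of_regular hreg)) (pow_pos hQ 2)
  obtain ⟨k, hkdef⟩ : ∃ k : ℝ, k = -((C1 a - C0 a) / (C1 a + delta28 a - phi30 a) ^ 2 * (cuspSlope a T δ / T)) :=
    ⟨_, rfl⟩
  have hk : 0 < k := by
    rw [hkdef, neg_pos]; exact mul_neg_of_pos_of_neg hκ (div_neg_of_neg_of_pos hslope hT)
  obtain ⟨r, hr, hball⟩ := Metric.eventually_nhds_iff.mp hmin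
  obtain ⟨ε, hεdef⟩ : ∃ ε : ℝ, ε = min (min ε₄ (r / (2 * (‖aOfS δ‖ + 1)))) (Real.exp (-(|C'| / k + 1))) :=
    ⟨_, rfl⟩
  have hε : 0 < ε := by rw [hεdef]; positivity
  have hε₁ : ε ≤ ε₄ := by rw [hεdef]; exact (min_le_left _ _).trans (min_le_left _ _)
  have hε₂ : ε ≤ r / (2 * (‖aOfS δ‖ + 1)) := by rw [hεdef]; exact (min_le_left _ _).trans (min_le_right _ _)
  have hε₃ : ε ≤ Real.exp (-(|C'| / k + 1)) := by rw [hεdef]; exact min_le_right _ _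
  have hlog : |C'| / k + 1 ≤ Real.log (1 / ε) := by
    rw [one_div, Real.log_inv]
    have h := Real.log_le_log hε hε₃
    rw [Real.log_exp] at h
    linarith
  have hdist : dist (aOfS (sParam a + ε • δ)) a < r := by
    rw [dist_aOfS_sParam_add_smul a hε.le δ]
    calc ε * ‖aOfS δ‖ ≤ r / (2 * (‖aOfS δ‖ + 1)) * ‖aOfS δ‖ := mul_le_mul_of_nonneg_right hε₂ (norm_nonneg _)
      _ ≤ r / (2 * (‖aOfS δ‖ + 1)) * (‖aOfS δ‖ + 1) :=
          mul_le_mul_of_nonneg_left (by linarith) (by positivity)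
      _ = r / 2 := by field_simp
      _ < r := by linarith
  have hle := hball hdist
  have hcusp := (abs_le.mp (hexp ε hε hε₁)).2
  have hk' : (C1 a - C0 a) / (C1 a + delta28 a - phi30 a) ^ 2 * (cuspSlope a T δ / T) = -k := by
    rw [hkdef, neg_neg]
  rw [hk'] at hcusp
  have hgain : 0 < k * ε * Real.log (1 / ε) - C' * ε := by
    have h1 : |C'| + k ≤ k * Real.log (1 / ε) := by
      have := mul_le_mul_of_nonneg_left hlog hk.le
      rw [mul_add, mul_one, mul_div_cancel₀ _ hk.ne'] at this
      exact this
    have h2 := le_abs_self C'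
    nlinarith
  linarith

/-- **At a Regular open-box local maximiser of `γ` (with `Q > 0`) every cusp slope is `≤ 0`** — for every period `T`
of the forms and every displacement `δ`. -/
theorem cuspSlope_nonpos_of_isLocalMax {a : Dir}
    (hopen : ∀ j : Fin 7, 0 < sParam a j.succ ∧ sParam a j.succ < sParam a 0)
    {T : ℝ} (hT : 0 < T) (hper : ∀ k : Fin 28, ∃ z : ℤ, T * h28 a k = z) (δ : Fin 8 → ℝ)
    (hQ : 0 < C1 a + delta28 a - phi30 a) (hreg : Regular a) (hmax : IsLocalMax gamma a) :
    cuspSlope a T δ ≤ 0 := by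
  by_contra h
  rw [not_le] at h
  exact not_isLocalMax_gamma_of_cuspSlope_pos hopen hT hper hQ hreg h hmax

end Summit.KontsevichZagierPeriods.Zeta5Search.Barrier.ConeGamma

end
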